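import Mathlib.Analysis.SpecialFunctions.Pow.Real
import Literature.NumberTheory.Irrationality.BrownZudilin2022.GeneralFamily
import Literature.Analysis.SpecialFunctions.LogChooseStirling
import HarnessLib

/-!
# ζ(5) search — certificates: two-sided bounds for Brown–Zudilin's leading coefficient `Q(p;q)` WITHOUT a recurrence

HONEST FRAMING: systematic search; no irrationality claim unless certified.

OUR work (Summit side; certifier 2, generic layer). Brown–Zudilin's leading coefficient (17),
`Q(p;q) = (−1)^{Σp} Σ_{k₁,k₂} (product of seven binomials)` (`BrownZudilin2022.Qcoeff`, integer binomials `zchoose`,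
zero off range), is `±` a sum of NON-NEGATIVE terms. Hence, for every parameter point and with no recurrence at all:

* `abs_Qcoeff_eq_sum` — `|Q(p;q)| = Σ_{k₁,k₂} qTerm p q k₁ k₂`;
* `qTerm_le_abs_Qcoeff` — (lower bound) `|Q(p;q)| ≥` any single term of the box;
* `zchoose_le_exp` — (Chernoff) for ALL integers `m, k` and every `t ∈ (0,1)`:
  `zchoose m k ≤ exp(k·(−log t) + (m−k)·(−log(1−t)))` (from `C(m,k)t^k(1−t)^{m−k} ≤ 1`; trivially when the binomial is `0`);
* `qTerm_le_exp` — the product bound with seven slopes `t₁,…,t₇`, exponent AFFINE in `(k₁, k₂)`;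
* `abs_Qcoeff_le_of_forall` — (upper bound) `|Q(p;q)| ≤ (q₁+1)(q₄+1)·B` if every term is `≤ B`;
* `log_choose_ge_scaled` — the tree's Stirling lower bound `LogChooseStirling.log_choose_ge_entropy` at scaled arguments
  `(αn, βn)`: `log C(αn, βn) ≥ n·(α log α − β log β − (α−β) log(α−β)) − log(αn)/2 − 2`.

These are the two halves of the RATE of `|Q(a·n)|` along any ray: the entropy of one lattice term from below, the
tangent plane (Chernoff bound at fixed rational slopes) of the concave entropy from above. Instantiated for the record
ray in `Certificates/RecordRayGrowth.lean`. Nothing here is specific to ζ(5) beyond the shape of (17).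
-/

noncomputable section

open Finset Real

namespace Summit.KontsevichZagierPeriods.Zeta5Search.BinomialSum

open Literature.NumberTheory.Irrationality.BrownZudilin2022 (zchoose Qcoeff)
open Literature.Analysis.SpecialFunctions (log_choose_ge_entropy entropy_eq_mul_scaled)

/-! ### Integer binomials -/

/-- `zchoose m k ≥ 0`. -/
theorem zchoose_nonneg (m k : ℤ) : 0 ≤ zchoose m k := by
  unfold zchoose; split_ifs <;> positivity

/-- `zchoose N K = C(n, k)` when `N = n`, `K = k` are casts of naturals with `k ≤ n`. -/
theorem zchoose_cast_eq {N K : ℤ} {n k : ℕ} (hN : N = n) (hK : K = k) (h : k ≤ n) :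
    zchoose N K = (n.choose k : ℤ) := by
  subst hN hK
  unfold zchoose
  rw [if_pos ⟨by positivity, by exact_mod_cast h⟩, Int.toNat_natCast, Int.toNat_natCast]

/-- **Chernoff bound for binomials**: `log C(m,k) ≤ k·(−log t) + (m−k)·(−log(1−t))` for `k ≤ m`, `0 < t < 1`. -/
theorem log_choose_le_chernoff {m k : ℕ} (hkm : k ≤ m) {t : ℝ} (h0 : 0 < t) (h1 : t < 1) :
    Real.log (m.choose k) ≤ k * (-Real.log t) + (m - k : ℝ) * (-Real.log (1 - t)) := by
  have h1' : 0 < 1 - t := by linarith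
  have hsum := add_pow t (1 - t) m
  rw [add_sub_cancel, one_pow] at hsum
  have hterm : (m.choose k : ℝ) * (t ^ k * (1 - t) ^ (m - k)) ≤ 1 := by
    have hle := Finset.single_le_sum (s := range (m + 1)) (a := k)
      (f := fun j => t ^ j * (1 - t) ^ (m - j) * (m.choose j : ℝ))
      (fun j _ => by positivity) (mem_range.mpr (Nat.lt_succ_of_le hkm))
    rw [← hsum] at hle
    linarith [hle]
  have hpos : 0 < t ^ k * (1 - t) ^ (m - k) := by positivity
  have hC : (m.choose k : ℝ) ≤ (t ^ k * (1 - t) ^ (m - k))⁻¹ := by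
    rw [← one_div]; exact (le_div_iff₀ hpos).mpr hterm
  have hlog := Real.log_le_log (by exact_mod_cast Nat.choose_pos hkm) hC
  rw [Real.log_inv, Real.log_mul (pow_pos h0 _).ne' (pow_pos h1' _).ne', Real.log_pow, Real.log_pow,
    Nat.cast_sub hkm] at hlog
  linarith

/-- **Chernoff bound, integer form**: for ALL integers `m, k` and `0 < t < 1`,
`zchoose m k ≤ exp(k·(−log t) + (m − k)·(−log(1 − t)))` (the binomial is `0` off `0 ≤ k ≤ m`). -/
theorem zchoose_le_exp (m k : ℤ) {t : ℝ} (h0 : 0 < t) (h1 : t < 1) :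
    ((zchoose m k : ℤ) : ℝ) ≤ Real.exp ((k : ℝ) * (-Real.log t) + ((m : ℝ) - k) * (-Real.log (1 - t))) := by
  by_cases h : 0 ≤ k ∧ k ≤ m
  · obtain ⟨n, hn⟩ := Int.eq_ofNat_of_zero_le (le_trans h.1 h.2)
    obtain ⟨j, hj⟩ := Int.eq_ofNat_of_zero_le h.1
    have hjn : j ≤ n := by omega
    rw [zchoose_cast_eq hn hj hjn]
    have hC := log_choose_le_chernoff hjn h0 h1
    have hpos : (0 : ℝ) < (n.choose j : ℕ) := by exact_mod_cast Nat.choose_pos hjn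
    calc (((n.choose j : ℕ) : ℤ) : ℝ) = Real.exp (Real.log (n.choose j)) := by
          push_cast; rw [Real.exp_log hpos]
      _ ≤ _ := by
          apply Real.exp_le_exp.mpr
          rw [hn, hj]; push_cast; exact hC
  · unfold zchoose; rw [if_neg h]; push_cast; positivity

/-! ### The summand of (17) and the sign-free sum -/

/-- The `(k₁,k₂)`-summand of (17): the product of its seven integer binomials (literally as in `Qcoeff`). -/
def qTerm (p : Fin 7 → ℤ) (q : Fin 5 → ℤ) (k₁ k₂ : ℤ) : ℤ :=
  zchoose k₁ (p 0) * zchoose k₂ (p 6) * zchoose (k₁ + k₂ + q 2 - p 0 - p 6) (p 3 + q 2 - p 0 - p 6)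
    * zchoose (q 0) (k₁ - p 1) * zchoose (q 1) (k₁ - p 2) * zchoose (q 3) (k₂ - p 4) * zchoose (q 4) (k₂ - p 5)

/-- Each summand is `≥ 0`. -/
theorem qTerm_nonneg (p : Fin 7 → ℤ) (q : Fin 5 → ℤ) (k₁ k₂ : ℤ) : 0 ≤ qTerm p q k₁ k₂ := by
  unfold qTerm
  have z := zchoose_nonneg
  exact mul_nonneg (mul_nonneg (mul_nonneg (mul_nonneg (mul_nonneg (mul_nonneg (z _ _) (z _ _)) (z _ _))
    (z _ _)) (z _ _)) (z _ _)) (z _ _)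

/-- `Q(p;q) = (−1)^{Σp} · Σ_{k₁} Σ_{k₂} qTerm` (definitional). -/
theorem Qcoeff_eq (p : Fin 7 → ℤ) (q : Fin 5 → ℤ) :
    Qcoeff p q = (-1) ^ (∑ i, p i).toNat *
      ∑ k₁ ∈ Icc (p 1) (p 1 + q 0), ∑ k₂ ∈ Icc (p 4) (p 4 + q 3), qTerm p q k₁ k₂ := rfl

/-- The sign-free sum is `≥ 0`. -/
theorem sum_qTerm_nonneg (p : Fin 7 → ℤ) (q : Fin 5 → ℤ) :
    0 ≤ ∑ k₁ ∈ Icc (p 1) (p 1 + q 0), ∑ k₂ ∈ Icc (p 4) (p 4 + q 3), qTerm p q k₁ k₂ :=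
  sum_nonneg fun _ _ => sum_nonneg fun _ _ => qTerm_nonneg _ _ _ _

/-- **`|Q(p;q)|` is the sum of the non-negative terms.** -/
theorem abs_Qcoeff_eq_sum (p : Fin 7 → ℤ) (q : Fin 5 → ℤ) :
    |(Qcoeff p q : ℝ)| = ∑ k₁ ∈ Icc (p 1) (p 1 + q 0), ∑ k₂ ∈ Icc (p 4) (p 4 + q 3), (qTerm p q k₁ k₂ : ℝ) := by
  rw [Qcoeff_eq]
  have h0 : (0 : ℝ) ≤ ∑ k₁ ∈ Icc (p 1) (p 1 + q 0), ∑ k₂ ∈ Icc (p 4) (p 4 + q 3), (qTerm p q k₁ k₂ : ℝ) := by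
    exact_mod_cast sum_qTerm_nonneg p q
  push_cast
  rw [abs_mul, abs_pow, abs_neg, abs_one, one_pow, one_mul, abs_of_nonneg h0]

/-- **Lower bound by one term**: for `(k₁,k₂)` in the box, `qTerm p q k₁ k₂ ≤ |Q(p;q)|`. -/
theorem qTerm_le_abs_Qcoeff (p : Fin 7 → ℤ) (q : Fin 5 → ℤ) {k₁ k₂ : ℤ}
    (hk₁ : k₁ ∈ Icc (p 1) (p 1 + q 0)) (hk₂ : k₂ ∈ Icc (p 4) (p 4 + q 3)) :
    (qTerm p q k₁ k₂ : ℝ) ≤ |(Qcoeff p q : ℝ)| := by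
  rw [abs_Qcoeff_eq_sum]
  have h2 : (qTerm p q k₁ k₂ : ℝ) ≤ ∑ j ∈ Icc (p 4) (p 4 + q 3), (qTerm p q k₁ j : ℝ) :=
    single_le_sum (f := fun j => (qTerm p q k₁ j : ℝ)) (fun j _ => by exact_mod_cast qTerm_nonneg p q k₁ j) hk₂
  exact h2.trans (single_le_sum (f := fun i => ∑ j ∈ Icc (p 4) (p 4 + q 3), (qTerm p q i j : ℝ))
    (fun i _ => sum_nonneg fun j _ => by exact_mod_cast qTerm_nonneg p q i j) hk₁)

/-- **Upper bound by the number of terms**: if every term of the box is `≤ B`, then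
`|Q(p;q)| ≤ (q₁ + 1)(q₄ + 1)·B` (for `q₁, q₄ ≥ 0`). -/
theorem abs_Qcoeff_le_of_forall (p : Fin 7 → ℤ) (q : Fin 5 → ℤ) (hq0 : 0 ≤ q 0) (hq3 : 0 ≤ q 3) {B : ℝ}
    (hB : ∀ k₁ ∈ Icc (p 1) (p 1 + q 0), ∀ k₂ ∈ Icc (p 4) (p 4 + q 3), (qTerm p q k₁ k₂ : ℝ) ≤ B) :
    |(Qcoeff p q : ℝ)| ≤ ((q 0 : ℝ) + 1) * ((q 3 : ℝ) + 1) * B := by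
  rw [abs_Qcoeff_eq_sum]
  have hc1 : ((Icc (p 1) (p 1 + q 0)).card : ℝ) = (q 0 : ℝ) + 1 := by
    rw [Int.card_Icc, show p 1 + q 0 + 1 - p 1 = q 0 + 1 by ring]
    have h : (((q 0 + 1).toNat : ℕ) : ℤ) = q 0 + 1 := Int.toNat_of_nonneg (by linarith)
    exact_mod_cast h
  have hc2 : ((Icc (p 4) (p 4 + q 3)).card : ℝ) = (q 3 : ℝ) + 1 := by
    rw [Int.card_Icc, show p 4 + q 3 + 1 - p 4 = q 3 + 1 by ring]
    have h : (((q 3 + 1).toNat : ℕ) : ℤ) = q 3 + 1 := Int.toNat_of_nonneg (by linarith)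
    exact_mod_cast h
  calc ∑ k₁ ∈ Icc (p 1) (p 1 + q 0), ∑ k₂ ∈ Icc (p 4) (p 4 + q 3), (qTerm p q k₁ k₂ : ℝ)
      ≤ ∑ k₁ ∈ Icc (p 1) (p 1 + q 0), ∑ _k₂ ∈ Icc (p 4) (p 4 + q 3), B :=
        sum_le_sum fun i hi => sum_le_sum fun j hj => hB i hi j hj
    _ = ((q 0 : ℝ) + 1) * ((q 3 : ℝ) + 1) * B := by
        rw [sum_const, sum_const, nsmul_eq_mul, nsmul_eq_mul, hc1, hc2]; ring

/-! ### The Chernoff bound for a whole term -/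

/-- Product of seven non-negative reals bounded factorwise. -/
theorem prod7_le {a₁ a₂ a₃ a₄ a₅ a₆ a₇ b₁ b₂ b₃ b₄ b₅ b₆ b₇ : ℝ}
    (ha₁ : 0 ≤ a₁) (ha₂ : 0 ≤ a₂) (ha₃ : 0 ≤ a₃) (ha₄ : 0 ≤ a₄) (ha₅ : 0 ≤ a₅) (ha₆ : 0 ≤ a₆) (ha₇ : 0 ≤ a₇)
    (h₁ : a₁ ≤ b₁) (h₂ : a₂ ≤ b₂) (h₃ : a₃ ≤ b₃) (h₄ : a₄ ≤ b₄) (h₅ : a₅ ≤ b₅) (h₆ : a₆ ≤ b₆) (h₇ : a₇ ≤ b₇) :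
    a₁ * a₂ * a₃ * a₄ * a₅ * a₆ * a₇ ≤ b₁ * b₂ * b₃ * b₄ * b₅ * b₆ * b₇ := by
  have hb₁ : 0 ≤ b₁ := ha₁.trans h₁
  have hb₂ : 0 ≤ b₂ := ha₂.trans h₂
  have hb₃ : 0 ≤ b₃ := ha₃.trans h₃
  have hb₄ : 0 ≤ b₄ := ha₄.trans h₄
  have hb₅ : 0 ≤ b₅ := ha₅.trans h₅
  have hb₆ : 0 ≤ b₆ := ha₆.trans h₆
  gcongr

/-- **Chernoff bound for a term of (17)**: for slopes `t₁,…,t₇ ∈ (0,1)` (one per binomial, in the order of `qTerm`),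
`qTerm p q k₁ k₂ ≤ exp(Φ)` with `Φ` the sum of the seven exponents `k·(−log t) + (m−k)·(−log(1−t))` — an AFFINE function
of `(k₁, k₂)`. -/
theorem qTerm_le_exp (p : Fin 7 → ℤ) (q : Fin 5 → ℤ) (k₁ k₂ : ℤ) {t₁ t₂ t₃ t₄ t₅ t₆ t₇ : ℝ}
    (h₁ : 0 < t₁ ∧ t₁ < 1) (h₂ : 0 < t₂ ∧ t₂ < 1) (h₃ : 0 < t₃ ∧ t₃ < 1) (h₄ : 0 < t₄ ∧ t₄ < 1)
    (h₅ : 0 < t₅ ∧ t₅ < 1) (h₆ : 0 < t₆ ∧ t₆ < 1) (h₇ : 0 < t₇ ∧ t₇ < 1) :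
    (qTerm p q k₁ k₂ : ℝ) ≤ Real.exp (
      ((p 0 : ℝ) * (-Real.log t₁) + ((k₁ : ℝ) - p 0) * (-Real.log (1 - t₁)))
      + ((p 6 : ℝ) * (-Real.log t₂) + ((k₂ : ℝ) - p 6) * (-Real.log (1 - t₂)))
      + (((p 3 + q 2 - p 0 - p 6 : ℤ) : ℝ) * (-Real.log t₃)
          + (((k₁ + k₂ + q 2 - p 0 - p 6 : ℤ) : ℝ) - ((p 3 + q 2 - p 0 - p 6 : ℤ) : ℝ)) * (-Real.log (1 - t₃)))
      + ((((k₁ - p 1 : ℤ)) : ℝ) * (-Real.log t₄) + ((q 0 : ℝ) - ((k₁ - p 1 : ℤ) : ℝ)) * (-Real.log (1 - t₄)))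
      + ((((k₁ - p 2 : ℤ)) : ℝ) * (-Real.log t₅) + ((q 1 : ℝ) - ((k₁ - p 2 : ℤ) : ℝ)) * (-Real.log (1 - t₅)))
      + ((((k₂ - p 4 : ℤ)) : ℝ) * (-Real.log t₆) + ((q 3 : ℝ) - ((k₂ - p 4 : ℤ) : ℝ)) * (-Real.log (1 - t₆)))
      + ((((k₂ - p 5 : ℤ)) : ℝ) * (-Real.log t₇) + ((q 4 : ℝ) - ((k₂ - p 5 : ℤ) : ℝ)) * (-Real.log (1 - t₇)))) := by
  unfold qTerm
  push_cast
  have z := zchoose_nonneg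
  have e1 := zchoose_le_exp k₁ (p 0) h₁.1 h₁.2
  have e2 := zchoose_le_exp k₂ (p 6) h₂.1 h₂.2
  have e3 := zchoose_le_exp (k₁ + k₂ + q 2 - p 0 - p 6) (p 3 + q 2 - p 0 - p 6) h₃.1 h₃.2
  have e4 := zchoose_le_exp (q 0) (k₁ - p 1) h₄.1 h₄.2
  have e5 := zchoose_le_exp (q 1) (k₁ - p 2) h₅.1 h₅.2
  have e6 := zchoose_le_exp (q 3) (k₂ - p 4) h₆.1 h₆.2
  have e7 := zchoose_le_exp (q 4) (k₂ - p 5) h₇.1 h₇.2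
  push_cast at e1 e2 e3 e4 e5 e6 e7
  refine le_trans (prod7_le (by exact_mod_cast z _ _) (by exact_mod_cast z _ _) (by exact_mod_cast z _ _)
    (by exact_mod_cast z _ _) (by exact_mod_cast z _ _) (by exact_mod_cast z _ _) (by exact_mod_cast z _ _)
    e1 e2 e3 e4 e5 e6 e7) (le_of_eq ?_)
  simp only [← Real.exp_add]

/-! ### The entropy lower bound at scaled arguments -/

/-- **Stirling lower bound at a lattice point of a ray**: for naturals `β ≤ α`, `1 ≤ α` and `n ≥ 1`,
`log C(αn, βn) ≥ n·(α log α − β log β − (α − β) log(α − β)) − log(αn)/2 − 2`. -/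
theorem log_choose_ge_scaled {α β : ℕ} (hβ : β ≤ α) (hα : 1 ≤ α) {n : ℕ} (hn : 1 ≤ n) :
    (n : ℝ) * ((α : ℝ) * Real.log α - (β : ℝ) * Real.log β - ((α : ℝ) - β) * Real.log ((α : ℝ) - β))
        - Real.log ((α * n : ℕ) : ℝ) / 2 - 2 ≤ Real.log ((α * n).choose (β * n)) := by
  have h := log_choose_ge_entropy (m := α * n) (k := β * n) (by nlinarith) (Nat.mul_le_mul_right n hβ)
  have hnpos : (0 : ℝ) < n := by exact_mod_cast hn
  have hscale := entropy_eq_mul_scaled hnpos ((α * n : ℕ) : ℝ) ((β * n : ℕ) : ℝ)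
  have e1 : ((α * n : ℕ) : ℝ) / n = α := by push_cast; field_simp
  have e2 : ((β * n : ℕ) : ℝ) / n = β := by push_cast; field_simp
  rw [e1, e2] at hscale
  rw [hscale] at h
  linarith

end Summit.KontsevichZagierPeriods.Zeta5Search.BinomialSum
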